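import Summits.QuantumAdvantage.QuantumAdvantage.Theorems.SosSandwichPseudoBoundedAAClassicalCornerSpectralDuality
import Summits.QuantumAdvantage.QuantumAdvantage.Theorems.SosSandwichPseudoBoundedAAClassicalCornerL2OSSSNoGoBalanced
import HarnessLib

/-!
# Crux `PseudoBoundedAA` (stmt-QuantumAdvantage-15237, route SosSandwich) — classical corner: the spectral constant
# `Φ(t) = Σ_{S≠∅} F̂(S)²/δ_t(S)` of decision trees is UNBOUNDED

Support file (`--supports stmt-QuantumAdvantage-15237`): the explicit corollary of `four_cov_sq_le_phi_mul`
(`…ClassicalCornerSpectralDuality.lean`: `4·Cov[F,g]² ≤ Φ(t)·Σⱼδⱼ(t)Infⱼ[g]`) and `not_exists_bilinear_osss`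
(`…ClassicalCornerL2OSSSNoGoBalanced.lean`: no `A` with `Cov[F,g]² ≤ A·Σⱼδⱼ(t)Infⱼ[g]`):

* **`exists_phi_gt`** — for every real `M` there is a decision tree `t` (with `0/1` output `F`) whose spectral constant
  exceeds `M`: `Σ_{S≠∅} F̂(S)²/δ_t(S) > M`.  Equivalently the `F̂²`-weighted HARMONIC mean of the query weights `δ_t(S)`
  can be arbitrarily small relative to `Var F` (OSSS bounds the arithmetic mean from below), and the per-tree route to
  the census's `L²`-OSSS law gives depth-dependent constants only (`C₀ ≤ 4·sup Φ`, `…PhiMaxLaw.lean`; `Φ ≤ ¼ I[F]`,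
  `…PhiLeTotalInfluence.lean`).

Honest label: calibration inside the classical corner of an open conjecture; no stub, crux or summit is closed.
Sources: R. O'Donnell, *Analysis of Boolean Functions* (2014) §3.4, §8.6; O'Donnell–Saks–Schramm–Servedio, FOCS 2005.
-/

set_option linter.dupNamespace false

noncomputable section

namespace Summit.QuantumAdvantage.QuantumAdvantage.Theorems.SosSandwich

open Finset Function
open Literature.Computability.Complexity
open Literature.Computability.Complexity.LowDegree (cubeFourierCoeff)

namespace ClassicalCornerSpectralDuality

/-- **`sup_t Φ(t) = ∞`.**  For every `M` some decision tree `t` with `0/1` output `F` has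
`Σ_{S≠∅} F̂(S)²/δ_t(S) > M` (`δ_t(S) = Σ_{j∈S} #{x : j ∈ t.queries x}/2^N`). [folklore] -/
theorem exists_phi_gt (M : ℝ) :
    ∃ (N : ℕ) (t : DecisionTree N) (F : (Fin N → Bool) → ℝ),
      (∀ x, F x = if t.eval x = true then (1 : ℝ) else 0) ∧
      M < ∑ S ∈ Finset.univ.filter (fun S : Finset (Fin N) => S.Nonempty), cubeFourierCoeff F S ^ 2 /
        ∑ j ∈ S, ((Finset.univ.filter fun x : Fin N → Bool => j ∈ t.queries x).card : ℝ) / (2 : ℝ) ^ N := by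
  classical
  by_contra h
  push Not at h
  apply ClassicalCornerL2OSSSNoGoBalanced.not_exists_bilinear_osss
  refine ⟨M / 4, fun N t g F hF => ?_⟩
  have hΦ := h N t F hF
  have hdual := four_cov_sq_le_phi_mul t F g hF
  have h2N : (0 : ℝ) < (2 : ℝ) ^ N := by positivity
  have h4 : (4 : ℝ) ^ N = (2 : ℝ) ^ N * (2 : ℝ) ^ N := by rw [← mul_pow]; norm_num
  -- the normalised right-hand side is nonnegative, so `Φ ≤ M` can be inserted
  have hB0 : 0 ≤ ∑ j, (((Finset.univ.filter fun x : Fin N → Bool => j ∈ t.queries x).card : ℝ) / (2 : ℝ) ^ N) *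
      ((∑ x, (g (update x j true) - g (update x j false)) ^ 2) / (2 : ℝ) ^ N) :=
    Finset.sum_nonneg fun j _ => mul_nonneg (by positivity)
      (div_nonneg (Finset.sum_nonneg fun x _ => sq_nonneg _) h2N.le)
  have hstep : 4 * ((∑ x, F x * g x) / (2 : ℝ) ^ N - ((∑ x, F x) / (2 : ℝ) ^ N) * ((∑ x, g x) / (2 : ℝ) ^ N)) ^ 2 ≤
      M * ∑ j, (((Finset.univ.filter fun x : Fin N → Bool => j ∈ t.queries x).card : ℝ) / (2 : ℝ) ^ N) *
        ((∑ x, (g (update x j true) - g (update x j false)) ^ 2) / (2 : ℝ) ^ N) :=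
    hdual.trans (mul_le_mul_of_nonneg_right hΦ hB0)
  -- un-normalise: `Cov_n = Cov_un/4^N`, `Σ δ_j S_j/2^N = (Σ W_j S_j)/4^N`
  have hcov : (∑ x, F x * g x) / (2 : ℝ) ^ N - ((∑ x, F x) / (2 : ℝ) ^ N) * ((∑ x, g x) / (2 : ℝ) ^ N) =
      ((2 : ℝ) ^ N * (∑ x, F x * g x) - (∑ x, F x) * (∑ x, g x)) / (4 : ℝ) ^ N := by
    rw [h4]; field_simp
  have hsum : ∑ j, (((Finset.univ.filter fun x : Fin N → Bool => j ∈ t.queries x).card : ℝ) / (2 : ℝ) ^ N) *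
        ((∑ x, (g (update x j true) - g (update x j false)) ^ 2) / (2 : ℝ) ^ N) =
      (∑ j, ((Finset.univ.filter fun x : Fin N → Bool => j ∈ t.queries x).card : ℝ) *
        ∑ x, (g (update x j true) - g (update x j false)) ^ 2) / (4 : ℝ) ^ N := by
    rw [h4, Finset.sum_div]
    refine Finset.sum_congr rfl fun j _ => ?_
    field_simp
  rw [hcov, hsum] at hstep
  have h4N : (0 : ℝ) < (4 : ℝ) ^ N := by positivity
  set C : ℝ := (2 : ℝ) ^ N * (∑ x, F x * g x) - (∑ x, F x) * (∑ x, g x) with hC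
  set WS : ℝ := ∑ j, ((Finset.univ.filter fun x : Fin N → Bool => j ∈ t.queries x).card : ℝ) *
    ∑ x, (g (update x j true) - g (update x j false)) ^ 2 with hWS
  -- `4 C²/16^N ≤ M·WS/4^N`  ⇒  `C² ≤ (M/4)·(4^N·WS)`
  rw [div_pow, ← mul_div_assoc, div_le_iff₀ (by positivity)] at hstep
  have e : M * (WS / (4 : ℝ) ^ N) * ((4 : ℝ) ^ N) ^ 2 = 4 * (M / 4 * ((4 : ℝ) ^ N * WS)) := by
    field_simp
  rw [e] at hstep
  linarith

end ClassicalCornerSpectralDuality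

end Summit.QuantumAdvantage.QuantumAdvantage.Theorems.SosSandwich

end
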